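import Literature.NumberTheory.Sieve.RosserSieveTheoremOneHalfLt
import Literature.NumberTheory.Sieve.RosserSieveBetaOneBound
import Literature.NumberTheory.Sieve.BetaSieveSmallDimension
import Literature.NumberTheory.Sieve.SieveFunctionsBridge
import HarnessLib

/-!
# The `β`-sieve theorems in the notation of `jurkat_richert_lower/upper` for `1/2 ≤ κ ≤ 1`, PROVED

Topic `Literature/NumberTheory/Sieve`. The named fact `SieveSequence.jurkat_richert_lower` (least-`β`
functions, all `κ ≥ 1/2`) is REFUTED in the tree (`SieveSequence.not_jurkat_richert_lower`, `κ = 2`); its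
faithful correction `SieveSequence.Iwaniec1980_lower` (Iwaniec's greatest-`β` functions) is now PROVED for
every `κ > 1/2` (`SieveSequence.Iwaniec1980_lower_of_half_lt`, `RosserSieveTheoremOneHalfLt.lean`), and
likewise the upper bound. For `1/2 ≤ κ ≤ 1` the least-`β` and greatest-`β` functions coincide
(`lowerSieveFun_eq_iwaniecLowerSieveFun`, `BetaSieveSmallDimension.lean`; for `κ = 1` also
`lowerSieveFun_one`, `SieveFunctionsBridge.lean`). Hence this file PROVES, unconditionally:

* `SieveSequence.jurkat_richert_lower_of_half_lt_of_le_one` / `…_upper_…` — the body of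
  `jurkat_richert_lower` / `jurkat_richert_upper` for `1/2 < κ ≤ 1` (the conditional tree versions
  `jurkat_richert_lower_of_le_one` take `Iwaniec1980_lower` as a hypothesis);
* `SieveSequence.linear_sieve_lower_holds` / `linear_sieve_upper_holds` — the LINEAR SIEVE of
  Jurkat–Richert (`κ = 1`, functions `F, f` of the linear sieve = `upperSieveFun 1`, `lowerSieveFun 1`)
  in level-of-distribution form: for a sifted sequence of dimension `Ω(1, L)` and level `x^θ`, for all
  `ε, δ > 0`, eventually in `x`, for all `2 ≤ z ≤ x^{θ − δ}`,
  `S(𝒜, z; x) ≥ X V(z) (f(θ log x/log z) − ε)` and `S(𝒜, z; x) ≤ X V(z) (F(θ log x/log z) + ε)`.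

The endpoint `κ = 1/2` (`β = 1`) is PROVED in `RosserSieveBetaOneBound.lean`
(`SieveSequence.Iwaniec1980_lower_holds` / `_upper_holds`, all `κ ≥ 1/2`); with it this file also gives the
closed range:

* `SieveSequence.jurkat_richert_lower_of_le_one_holds` / `…_upper_of_le_one_holds` — the unconditional forms
  of the two in-tree dependents `jurkat_richert_lower_of_le_one` / `jurkat_richert_upper_of_le_one`
  (`BetaSieveSmallDimension.lean`) of the refuted facts: the body of `jurkat_richert_lower/upper` for EVERY
  `1/2 ≤ κ ≤ 1`, i.e. exactly the range of dimensions in which the least-`β` functions `lowerSieveFun κ`,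
  `upperSieveFun κ` are Iwaniec's `f_κ, F_κ`.

## References

* H. Iwaniec, *Rosser's sieve*, Acta Arith. 36 (1980), 171–202, Theorem 1. [IwaniecActaArith1980]
* W. B. Jurkat, H.-E. Richert, *An improvement of Selberg's sieve method I*, Acta Arith. 11 (1965),
  217–240, Theorems 4–5. [JurkatRichertActaArith1965]
-/

open Filter Asymptotics

noncomputable section

namespace Literature.NumberTheory.Sieve

namespace SieveSequence

/-- **The `β`-sieve lower bound for `1/2 < κ ≤ 1` in the notation of `jurkat_richert_lower`, PROVED**
(unconditional form of `jurkat_richert_lower_of_le_one`). [cite: IwaniecActaArith1980, Thm 1] -/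
theorem jurkat_richert_lower_of_half_lt_of_le_one (A : SieveSequence) {κ L θ : ℝ}
    (hκ : 1 / 2 < κ) (hκ1 : κ ≤ 1) (hθ : 0 < θ) (hdim : HasIwaniecDimension A.density κ L)
    (hlevel : HasLevelOfDistribution A θ) (hsize : ∀ᶠ x : ℝ in atTop, 0 ≤ A.size x) :
    ∀ ε δ : ℝ, 0 < ε → 0 < δ → ∀ᶠ x : ℝ in atTop, ∀ z : ℝ, 2 ≤ z → z ≤ x ^ (θ - δ) →
      A.size x * A.densityProduct (primesProdBelow z) *
          (lowerSieveFun κ (θ * Real.log x / Real.log z) - ε) ≤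
        A.sifted x (primesProdBelow z) := by
  rw [lowerSieveFun_eq_iwaniecLowerSieveFun hκ.le hκ1]
  exact Iwaniec1980_lower_of_half_lt A hκ hθ hdim hlevel hsize

/-- **The `β`-sieve upper bound for `1/2 < κ ≤ 1` in the notation of `jurkat_richert_upper`, PROVED**
(unconditional form of `jurkat_richert_upper_of_le_one`). [cite: IwaniecActaArith1980, Thm 1] -/
theorem jurkat_richert_upper_of_half_lt_of_le_one (A : SieveSequence) {κ L θ : ℝ}
    (hκ : 1 / 2 < κ) (hκ1 : κ ≤ 1) (hθ : 0 < θ) (hdim : HasIwaniecDimension A.density κ L)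
    (hlevel : HasLevelOfDistribution A θ) (hsize : ∀ᶠ x : ℝ in atTop, 0 ≤ A.size x) :
    ∀ ε δ : ℝ, 0 < ε → 0 < δ → ∀ᶠ x : ℝ in atTop, ∀ z : ℝ, 2 ≤ z → z ≤ x ^ (θ - δ) →
      A.sifted x (primesProdBelow z) ≤
        A.size x * A.densityProduct (primesProdBelow z) *
          (upperSieveFun κ (θ * Real.log x / Real.log z) + ε) := by
  rw [upperSieveFun_eq_iwaniecUpperSieveFun hκ.le hκ1]
  exact Iwaniec1980_upper_of_half_lt A hκ hθ hdim hlevel hsize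

/-- **The linear sieve, lower bound (Jurkat–Richert), PROVED** — unconditional form of
`SieveSequence.linear_sieve_lower`: dimension `Ω(1, L)`, level of distribution `x^θ`, `X(x) ≥ 0`
eventually; then for all `ε, δ > 0`, eventually in `x`, for all `2 ≤ z ≤ x^{θ−δ}`,
`S(𝒜, z; x) ≥ X(x) V(z) (f(θ log x / log z) − ε)` with `f = lowerSieveFun 1`.
[cite: IwaniecActaArith1980, Thm 1] -/
theorem linear_sieve_lower_holds (A : SieveSequence) {L θ : ℝ} (hθ : 0 < θ)
    (hdim : HasIwaniecDimension A.density 1 L) (hlevel : HasLevelOfDistribution A θ)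
    (hsize : ∀ᶠ x : ℝ in atTop, 0 ≤ A.size x) :
    ∀ ε δ : ℝ, 0 < ε → 0 < δ → ∀ᶠ x : ℝ in atTop, ∀ z : ℝ, 2 ≤ z → z ≤ x ^ (θ - δ) →
      A.size x * A.densityProduct (primesProdBelow z) *
          (lowerSieveFun 1 (θ * Real.log x / Real.log z) - ε) ≤
        A.sifted x (primesProdBelow z) :=
  jurkat_richert_lower_of_half_lt_of_le_one A (by norm_num) le_rfl hθ hdim hlevel hsize

/-- **The linear sieve, upper bound (Jurkat–Richert), PROVED** — unconditional form of
`SieveSequence.linear_sieve_upper`, with `F = upperSieveFun 1`. [cite: IwaniecActaArith1980, Thm 1] -/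
theorem linear_sieve_upper_holds (A : SieveSequence) {L θ : ℝ} (hθ : 0 < θ)
    (hdim : HasIwaniecDimension A.density 1 L) (hlevel : HasLevelOfDistribution A θ)
    (hsize : ∀ᶠ x : ℝ in atTop, 0 ≤ A.size x) :
    ∀ ε δ : ℝ, 0 < ε → 0 < δ → ∀ᶠ x : ℝ in atTop, ∀ z : ℝ, 2 ≤ z → z ≤ x ^ (θ - δ) →
      A.sifted x (primesProdBelow z) ≤
        A.size x * A.densityProduct (primesProdBelow z) *
          (upperSieveFun 1 (θ * Real.log x / Real.log z) + ε) :=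
  jurkat_richert_upper_of_half_lt_of_le_one A (by norm_num) le_rfl hθ hdim hlevel hsize

/-- **The `β`-sieve lower bound for `1/2 ≤ κ ≤ 1` in the notation of `jurkat_richert_lower`, PROVED**:
the unconditional form of the dependent `jurkat_richert_lower_of_le_one` of the refuted named fact
`SieveSequence.jurkat_richert_lower`, fed with `SieveSequence.Iwaniec1980_lower_holds`. For a sifted sequence
of dimension `Ω(κ, L)`, `1/2 ≤ κ ≤ 1`, level of distribution `x^θ` and `X(x) ≥ 0` eventually: for all
`ε, δ > 0`, eventually in `x`, for all `2 ≤ z ≤ x^{θ−δ}`,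
`S(𝒜, z; x) ≥ X(x) V(z) (f_κ(θ log x / log z) − ε)` with `f_κ = lowerSieveFun κ`. (For `κ > 1` the
least-`β` function `lowerSieveFun κ` is not Iwaniec's `f_κ` and the statement fails at `κ = 2`,
`SieveSequence.not_jurkat_richert_lower`; the form valid for all `κ ≥ 1/2` is
`SieveSequence.Iwaniec1980_lower_holds`.) [cite: IwaniecActaArith1980, Thm 1 with (1.6)] -/
theorem jurkat_richert_lower_of_le_one_holds (A : SieveSequence) {κ L θ : ℝ}
    (hκ : 1 / 2 ≤ κ) (hκ1 : κ ≤ 1) (hθ : 0 < θ) (hdim : HasIwaniecDimension A.density κ L)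
    (hlevel : HasLevelOfDistribution A θ) (hsize : ∀ᶠ x : ℝ in atTop, 0 ≤ A.size x) :
    ∀ ε δ : ℝ, 0 < ε → 0 < δ → ∀ᶠ x : ℝ in atTop, ∀ z : ℝ, 2 ≤ z → z ≤ x ^ (θ - δ) →
      A.size x * A.densityProduct (primesProdBelow z) *
          (lowerSieveFun κ (θ * Real.log x / Real.log z) - ε) ≤
        A.sifted x (primesProdBelow z) :=
  jurkat_richert_lower_of_le_one Iwaniec1980_lower_holds A hκ hκ1 hθ hdim hlevel hsize

/-- **The `β`-sieve upper bound for `1/2 ≤ κ ≤ 1` in the notation of `jurkat_richert_upper`, PROVED**: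
the unconditional form of `jurkat_richert_upper_of_le_one`, fed with `SieveSequence.Iwaniec1980_upper_holds`:
`S(𝒜, z; x) ≤ X(x) V(z) (F_κ(θ log x / log z) + ε)` with `F_κ = upperSieveFun κ`, same hypotheses. (False
for `κ = 2` in the least-`β` reading, `SieveSequence.not_jurkat_richert_upper`; all `κ ≥ 1/2`:
`SieveSequence.Iwaniec1980_upper_holds`.) [cite: IwaniecActaArith1980, Thm 1 with (1.6)] -/
theorem jurkat_richert_upper_of_le_one_holds (A : SieveSequence) {κ L θ : ℝ}
    (hκ : 1 / 2 ≤ κ) (hκ1 : κ ≤ 1) (hθ : 0 < θ) (hdim : HasIwaniecDimension A.density κ L)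
    (hlevel : HasLevelOfDistribution A θ) (hsize : ∀ᶠ x : ℝ in atTop, 0 ≤ A.size x) :
    ∀ ε δ : ℝ, 0 < ε → 0 < δ → ∀ᶠ x : ℝ in atTop, ∀ z : ℝ, 2 ≤ z → z ≤ x ^ (θ - δ) →
      A.sifted x (primesProdBelow z) ≤
        A.size x * A.densityProduct (primesProdBelow z) *
          (upperSieveFun κ (θ * Real.log x / Real.log z) + ε) :=
  jurkat_richert_upper_of_le_one Iwaniec1980_upper_holds A hκ hκ1 hθ hdim hlevel hsize

end SieveSequence

end Literature.NumberTheory.Sieve
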